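import Literature.NumberTheory.LFunctions.MauduitRivatMatrixToolkit
import Literature.NumberTheory.LFunctions.MauduitRivatVanDerCorputNat
import Literature.NumberTheory.LFunctions.MoebiusAutomaticCarryTypeII
import Literature.NumberTheory.LFunctions.MauduitRivatTypeIITruncation
import Literature.NumberTheory.LFunctions.MauduitRivatFourier
import Literature.NumberTheory.LFunctions.MauduitRivatDiscreteFejer
import HarnessLib

/-!
# The opening of Mauduit–Rivat's type-II estimate for unitary-matrix weights: two van der Corput steps and the carry replacement ((51)–(56) of Mauduit–Rivat 2015, §5.4.2 of Müllner 2017; proved)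

Everything in this file is PROVED (plus plain definitions of the sums involved). It is the first
layer of the proof of the matrix-valued type-II estimate (C. Müllner, *Automatic sequences fulfill
the Sarnak conjecture*, Duke Math. J. 166 (2017), Prop. 5.5 = C. Mauduit, J. Rivat, J. Eur. Math.
Soc. 17 (2015), Prop. 2 for `f : ℕ → U_d`), in the OPENED form produced by the Cauchy–Schwarz
inequality and with INNER MATRIX COEFFICIENTS `B_n` (needed for the blocks whose smooth variable is
the longer one, cf. the module docstring of the assembly): for `F(n) = U(f(n))` with
`U : G →* U_d` and the twisted box sum

  `T = ∑_{M₀≤m<M₁} ‖∑_{N₀≤n<N₁} e(ϑmn) B_n F(mn)‖_F²`   (`typeIISq`),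

* `sq_typeIISq_le` — **van der Corput over `n`** (MR Lemma 3, (51)): for `1 ≤ R`,
  `R² T ≤ (N₁−N₀+R) R ((M₁−M₀) ∑_n ‖B_n‖² + 2 ∑_{1≤r<R} |S₁(r)|)` with
  `S₁(r) = ∑_m ∑_{n, n+r<N₁} e(−ϑmr) tr(B_{n+r}ᴴ B_n · F(mn) F(mn+mr)ᴴ)` (`corrS1`; Müllner p. 27:
  "as we are only interested in `tr(S₁(r))` we can exchange the order of the matrices" — the
  cyclicity of the trace brings `F(mn) F(mn+mr)ᴴ = U(f(mn) f(mn+mr)⁻¹)` together even with the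
  matrices `B` in between);
* `norm_corrS1_sub_le` — **the carry replacement** (MR (51)→`S₁'`, Müllner Lemma 5.2 =
  `card_carryExceptionsBox_le`): replacing `F` by `F_{μ₂} = U ∘ f_{μ₂}`, `μ₂ = μ + 2ρ`, costs
  `≤ 2√d ∑_{(m,n)∈E} ‖B_{n+r}‖ ‖B_n‖` on the k-adic box `[k^{μ-1},k^μ) × [k^{ν-1},k^ν)`, `r < k^ρ`;
* `norm_corrS1_le` — **Cauchy–Schwarz over `n`** (MR after (52)):
  `|S₁'(r)| ≤ (∑_n ‖B_{n+r}‖²‖B_n‖²)^{1/2} (∑_n ‖Y_r(n)‖²)^{1/2}`,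
  `Y_r(n) = ∑_m e(−ϑmr) F_{μ₂}(mn) F_{μ₂}(mn+mr)ᴴ` (`innerY`);
* `sq_sum_innerY_le` — **van der Corput over `m` with dilation `k^{μ₁}`** (MR (53)–(54)), for the
  family indexed by `(r, n)`: `S'² ∑_r ∑_n ‖Y_r(n)‖² ≤ (M₁−M₀+k^{μ₁}S') S' (d·#r·#n·#m + 2 ∑_{1≤s<S'} |S₂'(s)|)`
  with `S₂'(s) = ∑_r ∑_n ∑_{m, m+sk^{μ₁}<M₁} e(ϑ s k^{μ₁} r) tr(F_{μ₂}(x₁)F_{μ₂}(x₂)ᴴF_{μ₂}(x₃)F_{μ₂}(x₄)ᴴ)`,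
  `x₁ = (m+sk^{μ₁})(n+r)`, `x₂ = (m+sk^{μ₁})n`, `x₃ = mn`, `x₄ = m(n+r)` (`corrS2`);
* `trace_fourWord_eq` — **Müllner's `tr(S̃₂') = tr(S₂')`** (p. 28): the four-fold product is
  `tr U(φ(x₁) φ(x₂)⁻¹ φ(x₃) φ(x₄)⁻¹)` with `φ = f_{μ₁}⁻¹ f_{μ₂}` (`midQuot`), by `quot_word_conj` and
  the invariance of the trace under unitary conjugation.

## References
* C. Mauduit, J. Rivat, J. Eur. Math. Soc. 17 (2015) 2595–2642: Lemma 3, (51)–(56) (pp. 2601,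
  2611–2612). [MauduitRivat2015]
* C. Müllner, Duke Math. J. 166 (2017) 3219–3290 = arXiv:1602.03042: Lemma 5.2, §5.4.2
  (pp. 26–28). [Mullner2017]
-/

noncomputable section

open Finset Complex Matrix
open scoped FourierTransform InnerProductSpace ComplexConjugate Matrix.Norms.Frobenius

namespace Literature.NumberTheory.LFunctions.MauduitRivat

variable {d : Type*} [Fintype d] {G : Type*} [Group G]

/-! ## Exponential helpers -/

/-- `‖c • X‖ = ‖X‖` for a phase `c = e(x)`. [folklore] -/
theorem norm_fourierChar_smul {E : Type*} [NormedAddCommGroup E] [NormedSpace ℂ E] (x : ℝ) (X : E) :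
    ‖(𝐞 x : ℂ) • X‖ = ‖X‖ := by
  rw [norm_smul, norm_fourierChar, one_mul]

/-! ## The sums -/

/-- The unitary-matrix sequence `F(n) = U(f(n))`. [cite: Mullner2017, §4 (f : ℕ → U_d)] -/
abbrev umat [DecidableEq d] (U : G →* unitaryGroup d ℂ) (f : ℕ → G) (n : ℕ) : Matrix d d ℂ :=
  (U (f n) : Matrix d d ℂ)

/-- The OPENED twisted type-II box sum with inner matrix coefficients:
`T = ∑_{M₀≤m<M₁} ‖∑_{N₀≤n<N₁} e(ϑmn) B_n F(mn)‖²`.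
[cite: MauduitRivat2015, Prop. 2 (proof, first display)] -/
def typeIISq (ϑ : ℝ) (B F : ℕ → Matrix d d ℂ) (M₀ M₁ N₀ N₁ : ℕ) : ℝ :=
  ∑ m ∈ Ico M₀ M₁, ‖∑ n ∈ Ico N₀ N₁, (𝐞 (ϑ * m * n) : ℂ) • (B n * F (m * n))‖ ^ 2

/-- The first correlation sum
`S₁(r) = ∑_m ∑_{n, n+r<N₁} e(−ϑmr) tr(B_{n+r}ᴴ B_n F(mn) F(mn+mr)ᴴ)` (the trace form of MR's
`S₁(r)`, matrices ordered as in Müllner's `tr(S̃₁(r))`). [cite: MauduitRivat2015, (51)]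
[cite: Mullner2017, §5.4.2] -/
def corrS1 (ϑ : ℝ) (B F : ℕ → Matrix d d ℂ) (M₀ M₁ N₀ N₁ r : ℕ) : ℂ :=
  ∑ m ∈ Ico M₀ M₁, ∑ n ∈ (Ico N₀ N₁).filter (fun n => n + r < N₁),
    (𝐞 (-(ϑ * m * r)) : ℂ) * trace ((B (n + r))ᴴ * B n * (F (m * n) * (F (m * n + m * r))ᴴ))

/-- The inner `m`-sums after the Cauchy–Schwarz step over `n`:
`Y_r(n) = ∑_m e(−ϑmr) F(mn) F(mn+mr)ᴴ`. [cite: MauduitRivat2015, display before (53)] -/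
def innerY (ϑ : ℝ) (F : ℕ → Matrix d d ℂ) (M₀ M₁ r n : ℕ) : Matrix d d ℂ :=
  ∑ m ∈ Ico M₀ M₁, (𝐞 (-(ϑ * m * r)) : ℂ) • (F (m * n) * (F (m * n + m * r))ᴴ)

/-- The second correlation sum (MR's `S₂'` summed over `r`, for the shift `s`, dilation `L`):
`S₂'(s) = ∑_{1≤r<R} ∑_{N₀≤n<N₁} ∑_{m, m+sL<M₁} e(ϑ s L r) tr(F(x₁)F(x₂)ᴴF(x₃)F(x₄)ᴴ)`,
`x₁ = (m+sL)(n+r)`, `x₂ = (m+sL)n`, `x₃ = mn`, `x₄ = m(n+r)`. [cite: MauduitRivat2015, (54)] -/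
def corrS2 (ϑ : ℝ) (F : ℕ → Matrix d d ℂ) (M₀ M₁ N₀ N₁ R L s : ℕ) : ℂ :=
  ∑ r ∈ Ico 1 R, ∑ n ∈ Ico N₀ N₁, ∑ m ∈ (Ico M₀ M₁).filter (fun m => m + s * L < M₁),
    (𝐞 (ϑ * (s * L) * r) : ℂ) *
      trace (F ((m + s * L) * (n + r)) * (F ((m + s * L) * n))ᴴ * F (m * n) * (F (m * (n + r)))ᴴ)

/-! ## Van der Corput over `n` -/

/-- The inner product of two terms of the opened sum:
`⟪e(ϑm(n+r)) B' F', e(ϑmn) B F⟫ = e(−ϑmr) tr(B'ᴴ B F F'ᴴ)` (cyclicity of the trace).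
[cite: Mullner2017, §5.4.2 ("exchange the order of the matrices")] -/
theorem inner_term_eq (ϑ : ℝ) (m n r : ℕ) (B B' F F' : Matrix d d ℂ) :
    ⟪(𝐞 (ϑ * m * (n + r : ℕ)) : ℂ) • (B' * F'), (𝐞 (ϑ * m * n) : ℂ) • (B * F)⟫_ℂ =
      (𝐞 (-(ϑ * m * r)) : ℂ) * trace (B'ᴴ * B * (F * F'ᴴ)) := by
  rw [inner_smul_left, inner_smul_right, conj_coe_fourierChar, ← mul_assoc, coe_fourierChar_mul,
    inner_eq_trace, conjTranspose_mul]
  congr 1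
  · congr 1; push_cast; ring
  · -- `tr(F'ᴴ B'ᴴ (B F)) = tr(B'ᴴ B (F F'ᴴ))`
    conv_lhs => rw [Matrix.mul_assoc, trace_mul_comm]
    simp only [Matrix.mul_assoc]

/-- **MR (51) for unitary-matrix weights with inner matrix coefficients**: for `1 ≤ R`,
`R² T ≤ (N₁−N₀+R) R ((M₁−M₀) ∑_n ‖B_n‖² + 2 ∑_{1≤r<R} |S₁(r)|)`.
[cite: MauduitRivat2015, (51)] [cite: Mullner2017, §5.4.2] -/
theorem sq_typeIISq_le [DecidableEq d] (U : G →* unitaryGroup d ℂ) (f : ℕ → G) (ϑ : ℝ)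
    (B : ℕ → Matrix d d ℂ) {M₀ M₁ N₀ N₁ : ℕ} (hN : N₀ ≤ N₁) {R : ℕ} (hR : 1 ≤ R) :
    (R : ℝ) ^ 2 * typeIISq ϑ B (umat U f) M₀ M₁ N₀ N₁ ≤
      (((N₁ - N₀ : ℕ) : ℝ) + R) * (R * (((M₁ - M₀ : ℕ) : ℝ) * ∑ n ∈ Ico N₀ N₁, ‖B n‖ ^ 2 +
        2 * ∑ r ∈ Ico 1 R, ‖corrS1 ϑ B (umat U f) M₀ M₁ N₀ N₁ r‖)) := by
  set x : ℕ → ℕ → Matrix d d ℂ := fun m n => (𝐞 (ϑ * m * n) : ℂ) • (B n * umat U f (m * n)) with hx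
  have h := vanDerCorput_family_nat (Ico M₀ M₁) x hN hR (le_refl 1)
  simp only [Nat.cast_one, one_mul] at h
  -- the diagonal term
  have hdiag : ∑ m ∈ Ico M₀ M₁, ∑ n ∈ Ico N₀ N₁, ‖x m n‖ ^ 2 =
      ((M₁ - M₀ : ℕ) : ℝ) * ∑ n ∈ Ico N₀ N₁, ‖B n‖ ^ 2 := by
    have : ∀ m ∈ Ico M₀ M₁, ∑ n ∈ Ico N₀ N₁, ‖x m n‖ ^ 2 = ∑ n ∈ Ico N₀ N₁, ‖B n‖ ^ 2 := by
      intro m _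
      refine sum_congr rfl fun n _ => ?_
      rw [hx]; dsimp only
      rw [norm_fourierChar_smul, norm_mul_unitary]
    rw [sum_congr rfl this, sum_const, Nat.card_Ico, nsmul_eq_mul]
  -- the correlations
  have hcorr : ∀ r ∈ Ico 1 R, ∑ m ∈ Ico M₀ M₁, ∑ n ∈ (Ico N₀ N₁).filter (fun n => n + r < N₁),
      ⟪x m (n + r), x m n⟫_ℂ = corrS1 ϑ B (umat U f) M₀ M₁ N₀ N₁ r := by
    intro r _
    rw [corrS1]
    refine sum_congr rfl fun m _ => sum_congr rfl fun n _ => ?_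
    rw [hx]; dsimp only
    rw [show m * (n + r) = m * n + m * r by ring, inner_term_eq]
  have hcorr' : ∑ r ∈ Ico 1 R, ‖∑ m ∈ Ico M₀ M₁, ∑ n ∈ (Ico N₀ N₁).filter (fun n => n + r < N₁),
      ⟪x m (n + r), x m n⟫_ℂ‖ = ∑ r ∈ Ico 1 R, ‖corrS1 ϑ B (umat U f) M₀ M₁ N₀ N₁ r‖ :=
    sum_congr rfl fun r hr => by rw [hcorr r hr]
  rw [hdiag, hcorr'] at h
  exact h

/-! ## The carry replacement -/

/-- `F(x) F(y)ᴴ = U(f(x) f(y)⁻¹)` for the unitary-matrix sequence. [folklore] -/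
theorem umat_mul_conjTranspose [DecidableEq d] (U : G →* unitaryGroup d ℂ) (f : ℕ → G) (x y : ℕ) :
    umat U f x * (umat U f y)ᴴ = (U (f x * (f y)⁻¹) : Matrix d d ℂ) :=
  coe_map_mul_conjTranspose U (f x) (f y)

/-- One term of `S₁`: `|e(·) tr(B'ᴴ B X)| ≤ ‖B'‖ ‖B‖ ‖X‖`. [folklore] -/
theorem norm_term_le (x : ℝ) (B B' X : Matrix d d ℂ) :
    ‖(𝐞 x : ℂ) * trace (B'ᴴ * B * X)‖ ≤ ‖B'‖ * ‖B‖ * ‖X‖ := by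
  rw [norm_mul, norm_fourierChar, one_mul]
  refine (norm_trace_mul_le _ _).trans ?_
  gcongr
  exact (Matrix.frobenius_norm_mul _ _).trans (by rw [Matrix.frobenius_norm_conjTranspose])

/-- **The carry replacement in `S₁(r)`** (MR: "`S₁(r) = S₁'(r) + O(q^{μ+ν−ρ})`"; Müllner Lemma
5.2): on the k-adic box `[k^{μ-1}, k^μ) × [k^{ν-1}, k^ν)` and for `r < k^ρ`, replacing `F = U∘f` by
`F_{μ₂} = U ∘ f_{μ+2ρ}` changes `S₁(r)` by at most `2√d ∑_{(m,n)∈E} ‖B_{n+r}‖‖B_n‖`, `E` the carry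
exceptions of Lemma 5.2 (outside `E`, `f(mn+mr)f(mn)⁻¹ = f_{μ₂}(mn+mr) f_{μ₂}(mn)⁻¹` since
`mr < k^{μ+ρ}`). [cite: MauduitRivat2015, (51)–(52)] [cite: Mullner2017, Lemma 5.2 and (5.?) "tr(S₁(r)) = tr(S₁'(r)) + O(k^{μ+ν−ηρ})"] -/
theorem norm_corrS1_sub_le [DecidableEq d] (U : G →* unitaryGroup d ℂ) (f : ℕ → G) (ϑ : ℝ)
    (B : ℕ → Matrix d d ℂ) (k μ ν ρ : ℕ) {r : ℕ} (hr : r < k ^ ρ) :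
    ‖corrS1 ϑ B (umat U f) (k ^ (μ - 1)) (k ^ μ) (k ^ (ν - 1)) (k ^ ν) r -
        corrS1 ϑ B (umat U (trunc k (μ + 2 * ρ) f)) (k ^ (μ - 1)) (k ^ μ) (k ^ (ν - 1)) (k ^ ν) r‖ ≤
      2 * Real.sqrt (Fintype.card d) *
        ∑ p ∈ carryExceptionsBox k f μ ν ρ, ‖B (p.2 + r)‖ * ‖B p.2‖ := by
  classical
  set E := carryExceptionsBox k f μ ν ρ with hE
  -- write the difference as a sum over the box of the termwise differences
  set D : ℕ → ℕ → ℂ := fun m n =>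
    (𝐞 (-(ϑ * m * r)) : ℂ) * trace ((B (n + r))ᴴ * B n *
      (umat U f (m * n) * (umat U f (m * n + m * r))ᴴ -
        umat U (trunc k (μ + 2 * ρ) f) (m * n) * (umat U (trunc k (μ + 2 * ρ) f) (m * n + m * r))ᴴ))
    with hD
  have hdiff : corrS1 ϑ B (umat U f) (k ^ (μ - 1)) (k ^ μ) (k ^ (ν - 1)) (k ^ ν) r -
      corrS1 ϑ B (umat U (trunc k (μ + 2 * ρ) f)) (k ^ (μ - 1)) (k ^ μ) (k ^ (ν - 1)) (k ^ ν) r =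
      ∑ m ∈ Ico (k ^ (μ - 1)) (k ^ μ), ∑ n ∈ (Ico (k ^ (ν - 1)) (k ^ ν)).filter (fun n => n + r < k ^ ν),
        D m n := by
    rw [corrS1, corrS1, ← sum_sub_distrib]
    refine sum_congr rfl fun m _ => ?_
    rw [← sum_sub_distrib]
    refine sum_congr rfl fun n _ => ?_
    rw [hD]; dsimp only
    rw [← mul_sub, Matrix.mul_sub, trace_sub]
  -- outside `E` the term vanishes
  have hzero : ∀ m ∈ Ico (k ^ (μ - 1)) (k ^ μ), ∀ n ∈ (Ico (k ^ (ν - 1)) (k ^ ν)).filter (fun n => n + r < k ^ ν),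
      (m, n) ∉ E → D m n = 0 := by
    intro m hm n hn hmn
    rw [mem_Ico] at hm
    rw [mem_filter, mem_Ico] at hn
    have hquot : f (m * n + m * r) * (f (m * n))⁻¹ =
        trunc k (μ + 2 * ρ) f (m * n + m * r) * (trunc k (μ + 2 * ρ) f (m * n))⁻¹ := by
      by_contra hne
      apply hmn
      rw [hE, mem_carryExceptionsBox]
      refine ⟨⟨hm.1, hm.2⟩, ⟨hn.1.1, hn.1.2⟩, m * r, ?_, ?_⟩
      · calc m * r < k ^ μ * k ^ ρ := Nat.mul_lt_mul_of_le_of_lt hm.2.le hr (lt_of_le_of_lt (Nat.zero_le _) hm.2)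
          _ = k ^ (μ + ρ) := (pow_add _ _ _).symm
      · simpa [trunc_apply] using hne
    have hmat : umat U f (m * n) * (umat U f (m * n + m * r))ᴴ =
        umat U (trunc k (μ + 2 * ρ) f) (m * n) * (umat U (trunc k (μ + 2 * ρ) f) (m * n + m * r))ᴴ := by
      rw [umat_mul_conjTranspose, umat_mul_conjTranspose]
      -- `f(y) f(x)⁻¹ = (f(x) f(y)⁻¹)⁻¹`
      have h1 : f (m * n) * (f (m * n + m * r))⁻¹ = (f (m * n + m * r) * (f (m * n))⁻¹)⁻¹ := by group
      have h2 : trunc k (μ + 2 * ρ) f (m * n) * (trunc k (μ + 2 * ρ) f (m * n + m * r))⁻¹ =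
          (trunc k (μ + 2 * ρ) f (m * n + m * r) * (trunc k (μ + 2 * ρ) f (m * n))⁻¹)⁻¹ := by group
      rw [h1, h2, hquot]
    rw [hD]; dsimp only
    rw [hmat, sub_self, Matrix.mul_zero, trace_zero, mul_zero]
  -- bound each term on `E`
  have hbound : ∀ m n, ‖D m n‖ ≤ 2 * Real.sqrt (Fintype.card d) * (‖B (n + r)‖ * ‖B n‖) := by
    intro m n
    rw [hD]; dsimp only
    refine (norm_term_le _ _ _ _).trans ?_
    have hX : ‖umat U f (m * n) * (umat U f (m * n + m * r))ᴴ -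
        umat U (trunc k (μ + 2 * ρ) f) (m * n) * (umat U (trunc k (μ + 2 * ρ) f) (m * n + m * r))ᴴ‖ ≤
        2 * Real.sqrt (Fintype.card d) := by
      refine (norm_sub_le _ _).trans ?_
      rw [umat_mul_conjTranspose, umat_mul_conjTranspose, norm_coe_unitary, norm_coe_unitary]
      linarith
    calc ‖B (n + r)‖ * ‖B n‖ * ‖umat U f (m * n) * (umat U f (m * n + m * r))ᴴ -
          umat U (trunc k (μ + 2 * ρ) f) (m * n) * (umat U (trunc k (μ + 2 * ρ) f) (m * n + m * r))ᴴ‖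
        ≤ ‖B (n + r)‖ * ‖B n‖ * (2 * Real.sqrt (Fintype.card d)) := by gcongr
      _ = 2 * Real.sqrt (Fintype.card d) * (‖B (n + r)‖ * ‖B n‖) := by ring
  -- assemble: restrict the double sum to `E`
  rw [hdiff]
  calc ‖∑ m ∈ Ico (k ^ (μ - 1)) (k ^ μ), ∑ n ∈ (Ico (k ^ (ν - 1)) (k ^ ν)).filter (fun n => n + r < k ^ ν), D m n‖
      ≤ ∑ m ∈ Ico (k ^ (μ - 1)) (k ^ μ), ∑ n ∈ (Ico (k ^ (ν - 1)) (k ^ ν)).filter (fun n => n + r < k ^ ν),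
          ‖D m n‖ := (norm_sum_le _ _).trans (sum_le_sum fun m _ => norm_sum_le _ _)
    _ = ∑ p ∈ (Ico (k ^ (μ - 1)) (k ^ μ) ×ˢ (Ico (k ^ (ν - 1)) (k ^ ν)).filter (fun n => n + r < k ^ ν)),
          ‖D p.1 p.2‖ := (sum_product' _ _ fun m n => ‖D m n‖).symm
    _ = ∑ p ∈ (Ico (k ^ (μ - 1)) (k ^ μ) ×ˢ (Ico (k ^ (ν - 1)) (k ^ ν)).filter (fun n => n + r < k ^ ν)) ∩ E,
          ‖D p.1 p.2‖ := by
        refine (sum_subset inter_subset_left fun p hp hpE => ?_).symm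
        rw [mem_inter, not_and] at hpE
        have hp' := mem_product.1 hp
        rw [hzero p.1 hp'.1 p.2 hp'.2 (hpE hp), norm_zero]
    _ ≤ ∑ p ∈ E, ‖D p.1 p.2‖ := sum_le_sum_of_subset_of_nonneg inter_subset_right fun _ _ _ => norm_nonneg _
    _ ≤ ∑ p ∈ E, 2 * Real.sqrt (Fintype.card d) * (‖B (p.2 + r)‖ * ‖B p.2‖) := sum_le_sum fun p _ => hbound p.1 p.2
    _ = 2 * Real.sqrt (Fintype.card d) * ∑ p ∈ E, ‖B (p.2 + r)‖ * ‖B p.2‖ := by rw [mul_sum]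

/-- **Counting form of the carry error**: with `‖B_n‖ ≤ w(n)`, `0 ≤ w`,
`∑_{(m,n)∈E} ‖B_{n+r}‖‖B_n‖ ≤ (#E)^{1/2} ((M₁−M₀) ∑_{n} w(n+r)² w(n)²)^{1/2}` over the box
(Cauchy–Schwarz). [cite: MauduitRivat2015, (52)] -/
theorem sum_exceptions_le {E : Finset (ℕ × ℕ)} {M₀ M₁ N₀ N₁ : ℕ} (hE : E ⊆ Ico M₀ M₁ ×ˢ Ico N₀ N₁)
    {B : ℕ → Matrix d d ℂ} {w : ℕ → ℝ} (hw : ∀ n, 0 ≤ w n) (hB : ∀ n, ‖B n‖ ≤ w n) (r : ℕ) :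
    ∑ p ∈ E, ‖B (p.2 + r)‖ * ‖B p.2‖ ≤
      Real.sqrt E.card * Real.sqrt (((M₁ - M₀ : ℕ) : ℝ) * ∑ n ∈ Ico N₀ N₁, w (n + r) ^ 2 * w n ^ 2) := by
  have h1 : ∑ p ∈ E, ‖B (p.2 + r)‖ * ‖B p.2‖ ≤ ∑ p ∈ E, 1 * (w (p.2 + r) * w p.2) := by
    refine sum_le_sum fun p _ => ?_
    rw [one_mul]
    exact mul_le_mul (hB _) (hB _) (norm_nonneg _) (hw _)
  refine h1.trans ((Real.sum_mul_le_sqrt_mul_sqrt E (fun _ => (1 : ℝ)) fun p => w (p.2 + r) * w p.2).trans ?_)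
  simp only [one_pow, sum_const, nsmul_eq_mul, mul_one]
  gcongr
  calc ∑ p ∈ E, (w (p.2 + r) * w p.2) ^ 2 ≤ ∑ p ∈ Ico M₀ M₁ ×ˢ Ico N₀ N₁, (w (p.2 + r) * w p.2) ^ 2 :=
        sum_le_sum_of_subset_of_nonneg hE fun _ _ _ => sq_nonneg _
    _ = ((M₁ - M₀ : ℕ) : ℝ) * ∑ n ∈ Ico N₀ N₁, w (n + r) ^ 2 * w n ^ 2 := by
        rw [sum_product]
        dsimp only
        rw [sum_const, Nat.card_Ico, nsmul_eq_mul]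
        congr 1
        exact sum_congr rfl fun n _ => by ring

/-- The carry exceptions lie in the k-adic box. [folklore] -/
theorem carryExceptionsBox_subset_box (k : ℕ) (f : ℕ → G) (μ ν ρ : ℕ) :
    carryExceptionsBox k f μ ν ρ ⊆ Ico (k ^ (μ - 1)) (k ^ μ) ×ˢ Ico (k ^ (ν - 1)) (k ^ ν) := by
  intro p hp
  have h := mem_carryExceptionsBox.1 hp
  exact mem_product.2 ⟨mem_Ico.2 h.1, mem_Ico.2 h.2.1⟩

/-! ## Cauchy–Schwarz over `n` -/

/-- `S₁(r)` in terms of `Y_r(n)`: `S₁(r) = ∑_{n, n+r<N₁} tr(B_{n+r}ᴴ B_n Y_r(n))`. [folklore] -/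
theorem corrS1_eq_sum_trace (ϑ : ℝ) (B F : ℕ → Matrix d d ℂ) (M₀ M₁ N₀ N₁ r : ℕ) :
    corrS1 ϑ B F M₀ M₁ N₀ N₁ r =
      ∑ n ∈ (Ico N₀ N₁).filter (fun n => n + r < N₁), trace ((B (n + r))ᴴ * B n * innerY ϑ F M₀ M₁ r n) := by
  rw [corrS1, sum_comm]
  refine sum_congr rfl fun n _ => ?_
  rw [innerY, Matrix.mul_sum, trace_sum]
  refine sum_congr rfl fun m _ => ?_
  rw [Matrix.mul_smul, trace_smul, smul_eq_mul]

/-- **Cauchy–Schwarz over `n`** (MR: "`|S₁'(r)|² ≪ N ∑_n |∑_m …|²"`, with weights):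
`|S₁(r)| ≤ (∑_n ‖B_{n+r}‖²‖B_n‖²)^{1/2} (∑_n ‖Y_r(n)‖²)^{1/2}`, sums over `N₀ ≤ n < N₁`.
[cite: MauduitRivat2015, display after (52)] -/
theorem norm_corrS1_le (ϑ : ℝ) (B F : ℕ → Matrix d d ℂ) (M₀ M₁ N₀ N₁ r : ℕ) :
    ‖corrS1 ϑ B F M₀ M₁ N₀ N₁ r‖ ≤
      Real.sqrt (∑ n ∈ Ico N₀ N₁, (‖B (n + r)‖ * ‖B n‖) ^ 2) *
        Real.sqrt (∑ n ∈ Ico N₀ N₁, ‖innerY ϑ F M₀ M₁ r n‖ ^ 2) := by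
  rw [corrS1_eq_sum_trace]
  calc ‖∑ n ∈ (Ico N₀ N₁).filter (fun n => n + r < N₁), trace ((B (n + r))ᴴ * B n * innerY ϑ F M₀ M₁ r n)‖
      ≤ ∑ n ∈ (Ico N₀ N₁).filter (fun n => n + r < N₁), ‖trace ((B (n + r))ᴴ * B n * innerY ϑ F M₀ M₁ r n)‖ :=
        norm_sum_le _ _
    _ ≤ ∑ n ∈ Ico N₀ N₁, ‖trace ((B (n + r))ᴴ * B n * innerY ϑ F M₀ M₁ r n)‖ :=
        sum_le_sum_of_subset_of_nonneg (filter_subset _ _) fun _ _ _ => norm_nonneg _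
    _ ≤ ∑ n ∈ Ico N₀ N₁, (‖B (n + r)‖ * ‖B n‖) * ‖innerY ϑ F M₀ M₁ r n‖ := by
        refine sum_le_sum fun n _ => (norm_trace_mul_le _ _).trans ?_
        gcongr
        exact (Matrix.frobenius_norm_mul _ _).trans (by rw [Matrix.frobenius_norm_conjTranspose])
    _ ≤ _ := Real.sum_mul_le_sqrt_mul_sqrt _ _ _

/-! ## Van der Corput over `m` with dilation `k^{μ₁}` -/

/-- Each summand of `Y_r(n)` has Frobenius norm `√d` for unitary `F`. [folklore] -/
theorem norm_Y_term [DecidableEq d] (U : G →* unitaryGroup d ℂ) (f : ℕ → G) (x : ℝ) (a b : ℕ) :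
    ‖(𝐞 x : ℂ) • (umat U f a * (umat U f b)ᴴ)‖ = Real.sqrt (Fintype.card d) := by
  rw [norm_fourierChar_smul, umat_mul_conjTranspose, norm_coe_unitary]

/-- The inner product of two summands of `Y`:
`⟪e(−ϑ(m+L')r) F(x₂)F(x₁)ᴴ, e(−ϑmr) F(x₃)F(x₄)ᴴ⟫ = e(ϑL'r) tr(F(x₁)F(x₂)ᴴF(x₃)F(x₄)ᴴ)`. [folklore] -/
theorem inner_Y_terms (ϑ : ℝ) (m L' r : ℕ) (X₁ X₂ X₃ X₄ : Matrix d d ℂ) :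
    ⟪(𝐞 (-(ϑ * (m + L' : ℕ) * r)) : ℂ) • (X₂ * X₁ᴴ), (𝐞 (-(ϑ * m * r)) : ℂ) • (X₃ * X₄ᴴ)⟫_ℂ =
      (𝐞 (ϑ * L' * r) : ℂ) * trace (X₁ * X₂ᴴ * X₃ * X₄ᴴ) := by
  rw [inner_smul_left, inner_smul_right, conj_coe_fourierChar, ← mul_assoc, coe_fourierChar_mul,
    inner_eq_trace, conjTranspose_mul, conjTranspose_conjTranspose]
  congr 1
  · congr 1; push_cast; ring
  · simp only [Matrix.mul_assoc]

/-- **MR (53)–(54) for unitary-matrix weights**: van der Corput over `m` with dilation `L = k^{μ₁}`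
and `S'` shifts, for the family `(r, n)`:
`S'² ∑_{1≤r<R} ∑_{N₀≤n<N₁} ‖Y_r(n)‖² ≤ (M₁−M₀+L S') S' (d·(R−1)(N₁−N₀)(M₁−M₀) + 2 ∑_{1≤s<S'} |S₂'(s)|)`.
[cite: MauduitRivat2015, (53)–(54)] [cite: Mullner2017, §5.4.2] -/
theorem sq_sum_innerY_le [DecidableEq d] (U : G →* unitaryGroup d ℂ) (f : ℕ → G) (ϑ : ℝ) {M₀ M₁ : ℕ} (hM : M₀ ≤ M₁)
    (N₀ N₁ R : ℕ) {S' L : ℕ} (hS : 1 ≤ S') (hL : 1 ≤ L) :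
    (S' : ℝ) ^ 2 * ∑ r ∈ Ico 1 R, ∑ n ∈ Ico N₀ N₁, ‖innerY ϑ (umat U f) M₀ M₁ r n‖ ^ 2 ≤
      (((M₁ - M₀ : ℕ) : ℝ) + L * S') * (S' *
        ((Fintype.card d : ℝ) * ((R - 1 : ℕ) : ℝ) * ((N₁ - N₀ : ℕ) : ℝ) * ((M₁ - M₀ : ℕ) : ℝ) +
          2 * ∑ s ∈ Ico 1 S', ‖corrS2 ϑ (umat U f) M₀ M₁ N₀ N₁ R L s‖)) := by
  -- the family indexed by `(r, n)`, as sequences in `m`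
  set x : ℕ × ℕ → ℕ → Matrix d d ℂ := fun p m =>
    (𝐞 (-(ϑ * m * p.1)) : ℂ) • (umat U f (m * p.2) * (umat U f (m * p.2 + m * p.1))ᴴ) with hx
  have h := vanDerCorput_family_nat (Ico 1 R ×ˢ Ico N₀ N₁) x hM hS hL
  -- identify the left side
  have hleft : ∑ i ∈ Ico 1 R ×ˢ Ico N₀ N₁, ‖∑ m ∈ Ico M₀ M₁, x i m‖ ^ 2 =
      ∑ r ∈ Ico 1 R, ∑ n ∈ Ico N₀ N₁, ‖innerY ϑ (umat U f) M₀ M₁ r n‖ ^ 2 := by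
    rw [sum_product]
    rfl
  -- the diagonal term
  have hdiag : ∑ i ∈ Ico 1 R ×ˢ Ico N₀ N₁, ∑ m ∈ Ico M₀ M₁, ‖x i m‖ ^ 2 =
      (Fintype.card d : ℝ) * ((R - 1 : ℕ) : ℝ) * ((N₁ - N₀ : ℕ) : ℝ) * ((M₁ - M₀ : ℕ) : ℝ) := by
    have : ∀ i ∈ Ico 1 R ×ˢ Ico N₀ N₁, ∑ m ∈ Ico M₀ M₁, ‖x i m‖ ^ 2 = ((M₁ - M₀ : ℕ) : ℝ) * Fintype.card d := by
      intro i _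
      have : ∀ m ∈ Ico M₀ M₁, ‖x i m‖ ^ 2 = Fintype.card d := by
        intro m _
        rw [hx]; dsimp only
        rw [norm_Y_term, Real.sq_sqrt (Nat.cast_nonneg _)]
      rw [sum_congr rfl this, sum_const, Nat.card_Ico, nsmul_eq_mul]
    rw [sum_congr rfl this, sum_const, card_product, Nat.card_Ico, Nat.card_Ico, nsmul_eq_mul]
    push_cast; ring
  -- the correlations
  have hcorr : ∀ s ∈ Ico 1 S', ∑ i ∈ Ico 1 R ×ˢ Ico N₀ N₁,
      ∑ m ∈ (Ico M₀ M₁).filter (fun m => m + L * s < M₁), ⟪x i (m + L * s), x i m⟫_ℂ =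
        corrS2 ϑ (umat U f) M₀ M₁ N₀ N₁ R L s := by
    intro s _
    rw [corrS2, sum_product]
    refine sum_congr rfl fun r _ => sum_congr rfl fun n _ => ?_
    have hset : (Ico M₀ M₁).filter (fun m => m + L * s < M₁) = (Ico M₀ M₁).filter (fun m => m + s * L < M₁) := by
      congr 1; ext m; rw [mul_comm]
    rw [hset]
    refine sum_congr rfl fun m _ => ?_
    rw [hx]; dsimp only
    have e1 : (m + L * s) * n + (m + L * s) * r = (m + s * L) * (n + r) := by ring
    have e2 : (m + L * s) * n = (m + s * L) * n := by ring
    have e3 : m * n + m * r = m * (n + r) := by ring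
    rw [e1, e2, e3, show m + L * s = m + (s * L : ℕ) by ring, inner_Y_terms]
    congr 2
    push_cast; ring
  have hcorr' : ∑ s ∈ Ico 1 S', ‖∑ i ∈ Ico 1 R ×ˢ Ico N₀ N₁,
      ∑ m ∈ (Ico M₀ M₁).filter (fun m => m + L * s < M₁), ⟪x i (m + L * s), x i m⟫_ℂ‖ =
      ∑ s ∈ Ico 1 S', ‖corrS2 ϑ (umat U f) M₀ M₁ N₀ N₁ R L s‖ :=
    sum_congr rfl fun s hs => by rw [hcorr s hs]
  rw [hleft, hdiag, hcorr'] at h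
  exact h

/-! ## The trace of the four-fold product: `tr(S̃₂') = tr(S₂')` -/

/-- **Müllner's identity `tr(S̃₂'(r,s)) = tr(S₂'(r,s))`**: for `F = U ∘ f_{μ₂}` and the four
points `x₁ = (m+sk^{μ₁})(n+r)`, `x₂ = (m+sk^{μ₁})n`, `x₃ = mn`, `x₄ = m(n+r)`,
`tr(F(x₁)F(x₂)ᴴF(x₃)F(x₄)ᴴ) = tr U(φ(x₁) φ(x₂)⁻¹ φ(x₃) φ(x₄)⁻¹)` with `φ = f_{μ₁}⁻¹ f_{μ₂}`
(`midQuot`): the common prefix `f_{μ₁}(x₁) = f_{μ₁}(x₄)`, `f_{μ₁}(x₂) = f_{μ₁}(x₃)` conjugates the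
word (`quot_word_conj`) and the trace is invariant. [cite: Mullner2017, §5.4.2 (p. 28)] -/
theorem trace_fourWord_eq [DecidableEq d] (U : G →* unitaryGroup d ℂ) (f : ℕ → G) (k μ₁ μ₂ m n r s : ℕ) :
    trace (umat U (trunc k μ₂ f) ((m + s * k ^ μ₁) * (n + r)) * (umat U (trunc k μ₂ f) ((m + s * k ^ μ₁) * n))ᴴ *
        umat U (trunc k μ₂ f) (m * n) * (umat U (trunc k μ₂ f) (m * (n + r)))ᴴ) =
      trace (U (midQuot k μ₁ μ₂ f ((m + s * k ^ μ₁) * (n + r)) * (midQuot k μ₁ μ₂ f ((m + s * k ^ μ₁) * n))⁻¹ *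
        midQuot k μ₁ μ₂ f (m * n) * (midQuot k μ₁ μ₂ f (m * (n + r)))⁻¹) : Matrix d d ℂ) := by
  -- group identity
  have h14 : trunc k μ₁ f ((m + s * k ^ μ₁) * (n + r)) = trunc k μ₁ f (m * (n + r)) :=
    trunc_add_mul_pow_mul k μ₁ f m s (n + r)
  have h23 : trunc k μ₁ f ((m + s * k ^ μ₁) * n) = trunc k μ₁ f (m * n) :=
    trunc_add_mul_pow_mul k μ₁ f m s n
  have hw := quot_word_conj k μ₁ μ₂ f h14 h23
  -- matrices: `F(x₁)F(x₂)ᴴ · F(x₃)F(x₄)ᴴ = U(w(x₁,x₂) · w(x₄,x₃)⁻¹)`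
  rw [Matrix.mul_assoc (umat U (trunc k μ₂ f) ((m + s * k ^ μ₁) * (n + r)) * _),
    umat_mul_conjTranspose, umat_mul_conjTranspose, ← Submonoid.coe_mul, ← map_mul]
  have hinv : trunc k μ₂ f (m * n) * (trunc k μ₂ f (m * (n + r)))⁻¹ =
      (trunc k μ₂ f (m * (n + r)) * (trunc k μ₂ f (m * n))⁻¹)⁻¹ := by group
  rw [hinv, hw, map_mul, map_mul, Submonoid.coe_mul, Submonoid.coe_mul, map_inv, coe_inv_unitary,
    trace_unitary_conj]

end Literature.NumberTheory.LFunctions.MauduitRivat
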